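import Summits.BirchSwinnertonDyer.Rank1Residual.X5.TwoAdicAdditiveL2
import Literature.NumberTheory.EllipticCurves.Kato2004.AdditivePotGoodRankZeroShaUpperBoundFineSelmerAtTwoSharp
import Literature.NumberTheory.EllipticCurves.Rank1Residual.Typed.CasselsLowerBound
import HarnessLib

/-!
# Route `ByReductionTypeAtTwo` (rung K4), crux `AdditiveRankZeroAtTwo` (item stmt-BirchSwinnertonDyer-19098),
# line add_twist_overK v2, stub `stub_addDefectUpper` (hU3): the ∀ UPPER half on the E[2]-IRREDUCIBLE part of the
# defect-≥3 block REDUCED TO Coates–Sujatha's statement (A) at `(E, 2)` ALONE — the «+ 1» of the GEN 5 doors removed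
# (a `--supports` file; seat `bsd-2adic-addL2x` GEN 8; sequel of `ByReductionTypeAtTwoAdditiveKatoFineDescentAtTwo.lean`, kept OUTSIDE the
# route file's import cone: it imports neither the route file nor that sequel's predecessor)

HONEST FRAMING (cell `bsd-2adic`, HUMAN RULING D-0036/D-0054): types-the-object-of; closes none at the ∀-level;
nothing booked; BSD is not proved by any of this. The item is NOT closed by this file (conditional helpers).

WHAT THIS FILE DOES. The predecessor file (`…AdditiveKatoFineDescentAtTwo.lean`, ns `AddKatoTwo`, GEN 5) read the
registered stub `stub_addDefectUpper` — `∀ W` non-CM, `r_an = 0`, `DefectAtLeastThree W` ⟹ `MissingUpperBoundAt W 2` —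
through Kato at `p = 2` and obtained, GRANTED statement (A) at `(E,2)`, `ord₂ #Ш ≤ ord₂ #Ш_an + 1` on the
`E[2]`-irreducible sub-block; the `+ 1` was then removed PER CLASS by Cassels–Tate squareness and a certified-even
`ord₂ #Ш_an` (`…_of_even` doors). The SHARP Literature reading
`Kato2004.rankZero_padicValNat_sha_add_padicValNat_tamagawa_le_at_two_of_irreducible_of_fineSelmerDual_fg`
(file `Kato2004/AdditivePotGoodRankZeroShaUpperBoundFineSelmerAtTwoSharp.lean`, this seat GEN 8: the `+ 1` is the
divisibility `2 ∣ z'` in `𝐇'¹(T)`, which HOLDS — Kato Thm. 12.5 (1) prints `z_{ι(γ)} = −σ_{−1}(z_γ)`, so after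
the Tate twist Kato's element for `γ⁺` is fixed by complex conjugation at every level `ℚ(ζ_{2^{m+2}})`; it is
integral there because `𝐇¹(T)` is free over the REGULAR ring `ℤ₂[[Gal(ℚ(ζ_{2^∞})/ℚ(i))]]` by Kato's 13.8 run over
`ℚ(i)` and 12.6/13.14; a `c`-fixed integral class descends to `ℚ_m` by inflation–restriction, norm-compatibly, so
`z' = cores∘res y' = 2y'`) removes the `+ 1` AT THE ∀-LEVEL: on the `E[2]`-irreducible sub-block (1 145 of the
1 382 classes; both signs of `Δ`), `stub_addDefectUpper`'s conclusion at `W` follows from statement (A) at `(W, 2)`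
ALONE — no parity certificate, no Cassels–Tate. What is then left of hU3 is displayed exactly (§4): statement (A)
of Coates–Sujatha at `(E, 2)` on the irreducible sub-block (a NAMED PUBLISHED CONJECTURE, reduction-type-free) and
the upper half on the `E[2]`-REDUCIBLE sub-block (210 classes with a rational `2`-torsion point; no reading).

* §0 `katoFineSelmerAtTwo'_of_sharp`, `katoFineSelmerAtTwo_of_sharp` — the sharp reading feeds both GEN 5 binders
  (`hKato2'`, `hKato2`): pure logic.
* §1 `padicValNat_shaOrder_le_of_katoFineSelmerAtTwoSharp_rankZero` — the sharp reading in Miller's currency: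
  `#Ш_an = q`, `ord₂ #Ш ≤ ord₂ q − 2·ord₂ #E(ℚ)_tors`.
* §2 `missingUpperBoundAt_two_of_katoFineSelmerAtTwoSharp` — hU3 AT A CURVE of the sub-block {`E[2]` irreducible}
  from (A)`(W,2)` alone.
* §3 `bsdp_two_of_katoFineSelmerAtTwoSharp_of_lower` — `BSD₂(W)` at such a curve from (A)`(W,2)` and the LOWER half
  `MissingLowerBoundAt W 2`; `bsdp_two_of_katoFineSelmerAtTwoSharp_of_certificates` — the per-class door: (A)`(W,2)` +
  the two-engine lower certificate (`#Ш_an = q`, `ord₂ q ≤ 2k`, `2^{2k−1} ∣ #Ш`; Cassels–Tate only on the LOWER side).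
* §4 `addDefectUpper_irreducible_of_conjA` — the ∀ SHAPE: on {irreducible}, `stub_addDefectUpper`'s conclusion ⟸
  (A)`(E,2)`; `addDefectUpper_of_conjA_of_reducibleUpper` — the registered stub VERBATIM from (A) on the irreducible
  sub-block plus the upper half on the reducible sub-block (the exact residual); `addDefectBSDp_irreducible_of_conjA_of_lower`
  — on {irreducible}, `BSD₂` ⟸ (A)`(E,2)` + the lower half.

Binders (all BY NAME): `hSharp` = the sharp reading (Literature, flagged
`Kato-12.4(2)-12.5(1)(3)-12.6-13.8-13.14-14.14-at-two-anyDisc-irreducible-fineSelmer-fg-sharp`, D-audit owed);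
`hGZK` = Gross–Zagier–Kolyvagin; `hmod` = modularity; `hCT` = Cassels–Tate (lower side of §3 only). Memo:
`run/shared/lean/pub/bsd-2adic/addL2x/VERDICT-19098-addL2x-GEN8.md`.

References: [Kato2004Asterisque] (12.2.1) (p. 220), Thm. 12.4 (2)(3) (p. 221), Thm. 12.5 (1)(3) (pp. 221–222), Thm. 12.6
(p. 222), 13.8–13.9 (pp. 227–230), 13.14 (p. 234), 14.14 + Lemma 14.15 (pp. 243–244), Prop. 14.16 (2) (p. 244);
[Kato1999Kodai] Thm. 0.8; [CoatesSujatha2005] statement (A); [Lim2017FineSelmer] §3; [SilvermanAEC2009] Thm. X.4.14;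
[Miller2011LMS] Def. 1.1.
-/

set_option autoImplicit false
-- sibling precedent (`ByReductionTypeAtTwoAdditiveKatoFineDescentAtTwo.lean`): the directory name repeats the summit name
set_option linter.dupNamespace false

noncomputable section

open scoped Classical

namespace Summit.BirchSwinnertonDyer.BirchSwinnertonDyer.Theorems.AddKatoTwo

open WeierstrassCurve Literature.NumberTheory.EllipticCurves
  Literature.NumberTheory.EllipticCurves.Rank1Residual
  Literature.NumberTheory.EllipticCurves.Rank1Residual.Typed
  Summit.BirchSwinnertonDyer.Rank1Residual.AdditivePotMult
  Summit.BirchSwinnertonDyer.Rank1Residual.X5.AddTwoL2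

/-! ## §0 The sharp reading feeds the two GEN 5 binders -/

/-- The SHARP reading implies the `Δ`-free `+ 1` reading (binder `hKato2'` of the GEN 5 doors): one inequality weaker.
Bookkeeping, pure logic over the two Literature `def`s. [cite: Kato2004Asterisque, Thm. 12.5 (1)(3) (pp. 221–222)] -/
theorem katoFineSelmerAtTwo'_of_sharp
    (h : Kato2004.rankZero_padicValNat_sha_add_padicValNat_tamagawa_le_at_two_of_irreducible_of_fineSelmerDual_fg) :
    Kato2004.rankZero_padicValNat_sha_add_padicValNat_tamagawa_le_add_one_at_two_of_irreducible_of_fineSelmerDual_fg := by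
  intro W _ _ hcm hgood hmult hpot hirr hA hL hfin
  obtain ⟨q, hq, hle⟩ := h W hcm hgood hmult hpot hirr hA hL hfin
  exact ⟨q, hq, by linarith⟩

/-- The SHARP reading implies the `Δ < 0` `+ 1` reading (binder `hKato2` of the GEN 5 doors). Bookkeeping.
[cite: Kato2004Asterisque, Thm. 12.5 (1)(3) (pp. 221–222)] -/
theorem katoFineSelmerAtTwo_of_sharp
    (h : Kato2004.rankZero_padicValNat_sha_add_padicValNat_tamagawa_le_at_two_of_irreducible_of_fineSelmerDual_fg) :
    Kato2004.rankZero_padicValNat_sha_add_padicValNat_tamagawa_le_add_one_at_two_of_negDisc_of_irreducible_of_fineSelmerDual_fg := by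
  intro W _ _ hcm hgood hmult hpot _ hirr hA hL hfin
  obtain ⟨q, hq, hle⟩ := h W hcm hgood hmult hpot hirr hA hL hfin
  exact ⟨q, hq, by linarith⟩

/-! ## §1 The sharp reading in Miller's currency -/

/-- **Rank-`0` upper bound from the SHARP `p = 2` fine-Selmer reading**: for a non-CM globally minimal `W`, additive and
potentially good at `2`, with `E[2]` irreducible, `r_an = 0` and statement (A) at `(E,2)` (`hA`): `#Ш_an = q` and
`ord₂ #Ш ≤ ord₂ q − 2·ord₂ #E(ℚ)_tors` (the reading bounds `ord₂ #Ш + v₂(∏ c_ℓ)` by `ord₂(L/Ω)` and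
`#Ш_an = (L/Ω)·#tors²/∏ c_ℓ`). The `p = 2` twin, WITHOUT `+ 1`, of bsd-potss's `padicValNat_shaOrder_le_of_katoFineSelmer_rankZero`.
[cite: Kato2004Asterisque, Thm. 12.5 (1)(3) (pp. 221–222), 13.8 (pp. 227–229), 14.14 and Lemma 14.15 (pp. 243–244)]
[cite: CoatesSujatha2005, statement (A)] [cite: Miller2011LMS, Def. 1.1] -/
theorem padicValNat_shaOrder_le_of_katoFineSelmerAtTwoSharp_rankZero
    (hSharp : Kato2004.rankZero_padicValNat_sha_add_padicValNat_tamagawa_le_at_two_of_irreducible_of_fineSelmerDual_fg)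
    (hGZK : rank_eq_analyticRank_of_analyticRank_le_one) (hmod : hasEntireLFunction_rat)
    (W : WeierstrassCurve ℚ) [W.IsElliptic] [W.IsGloballyMinimal] (hcm : ¬ W.HasCM)
    (hgood : ¬ W.HasGoodReductionAtPrime 2) (hmult : ¬ W.HasMultiplicativeReductionAtPrime 2)
    (hpot : 0 ≤ padicValRat 2 W.j) (hirr : W.HasIrreducibleModPGaloisRep 2)
    (hA : ∀ (κ : ZpExtension ℚ 2), κ.IsCyclotomic →
      ∃ (γ : Field.absoluteGaloisGroup ℚ) (D : W.FineSelmerDualData κ γ),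
        Module.Finite ℤ_[2] (RestrictScalars ℤ_[2] (IwasawaAlgebra 2) D.X))
    (hr : W.analyticRank = 0) :
    ∃ q : ℚ, shaAn W = (q : ℂ) ∧
      (padicValNat 2 W.shaOrder : ℤ) ≤ padicValRat 2 q - 2 * padicValNat 2 W.torsionOrder := by
  have hL : W.entireLFunction 1 ≠ 0 := (W.analyticRank_eq_zero_iff_holds (hmod W)).mp hr
  obtain ⟨hmw, hfin⟩ := hGZK W (by rw [hr]; exact zero_le_one)
  haveI : Finite W.sha := hfin
  have hmw0 : W.mordellWeilRank = 0 := by rw [hmw, hr]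
  obtain ⟨q₀, hq₀, hle⟩ := hSharp W hcm hgood hmult hpot hirr hA hL hfin
  have hΩpos : 0 < W.realPeriodRat := W.realPeriodRat_pos_holds
  have hΩ : (W.realPeriodRat : ℂ) ≠ 0 := by exact_mod_cast hΩpos.ne'
  have hc0 : 0 < W.tamagawaProduct := W.tamagawaProduct_pos_holds
  have ht0 : 0 < W.torsionOrder := W.torsionOrder_pos_holds
  have hq₀0 : q₀ ≠ 0 := by
    rintro rfl
    rw [Rat.cast_zero, div_eq_zero_iff] at hq₀
    exact hq₀.elim hL hΩ
  refine ⟨q₀ * (W.torsionOrder : ℚ) ^ 2 / (W.tamagawaProduct : ℚ), ?_, ?_⟩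
  · have hLq : W.entireLFunction 1 = (q₀ : ℂ) * (W.realPeriodRat : ℂ) := by
      rw [← hq₀, div_mul_cancel₀ _ hΩ]
    rw [shaAn_def, leadingLCoeff_eq_of_analyticRank_eq_zero W hr,
      W.regulator_eq_one_of_rank_zero hmw0, hLq]
    push_cast
    field_simp
  · have ht : (W.torsionOrder : ℚ) ≠ 0 := by exact_mod_cast ht0.ne'
    have hcq : (W.tamagawaProduct : ℚ) ≠ 0 := by exact_mod_cast hc0.ne'
    have hsha : padicValNat 2 (Nat.card (AddCommGroup.primaryComponent W.sha 2)) =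
        padicValNat 2 W.shaOrder := by
      unfold WeierstrassCurve.shaOrder
      exact padicValNat_card_addPrimaryComponent 2
    have hv : padicValRat 2 (q₀ * (W.torsionOrder : ℚ) ^ 2 / (W.tamagawaProduct : ℚ)) =
        padicValRat 2 q₀ + 2 * (padicValNat 2 W.torsionOrder : ℤ) -
          (padicValNat 2 W.tamagawaProduct : ℤ) := by
      rw [padicValRat.div (mul_ne_zero hq₀0 (pow_ne_zero 2 ht)) hcq,
        padicValRat.mul hq₀0 (pow_ne_zero 2 ht), pow_two, padicValRat.mul ht ht,
        padicValRat.of_nat, padicValRat.of_nat]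
      ring
    rw [hv, ← hsha]
    linarith

/-! ## §2 hU3 AT A CURVE of the sub-block {E[2] irreducible} from statement (A) ALONE -/

/-- Defect `≥ 3` ⇒ potentially good at `2` (not quadratically semistabilisable ⇒ not potentially multiplicative,
`quadSemistabilisable_of_potMult`). Private twin of the GEN 5 lemma `padicValRat_j_nonneg_of_defectAtLeastThree` (kept private so that
this file stays outside the route file's import cone). [folklore] -/
private theorem potGood_of_defectAtLeastThree (W : WeierstrassCurve ℚ) [W.IsElliptic]
    (hdef : DefectAtLeastThree W) : 0 ≤ padicValRat 2 W.j := by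
  by_contra hlt
  exact hdef.2 (quadSemistabilisable_of_potMult W ⟨hdef.1, lt_of_not_ge hlt⟩)

/-- **hU3 at a curve from statement (A) at `(E,2)` — no parity certificate, no Cassels–Tate.** On the sub-block
{`E[2]` irreducible} of the defect-≥3 block (additive at `2`, potentially good: not quadratically semistabilisable ⇒ not potentially multiplicative),
granted the SHARP `p = 2` reading, GZK and modularity: if (A) holds at `(W,2)` then `MissingUpperBoundAt W 2`
(torsion term `0` by irreducibility, `padicValNat_torsionOrder_eq_zero_of_irreducible`).
[cite: Kato2004Asterisque, Thm. 12.5 (1)(3) (pp. 221–222), 13.8 (pp. 227–229), 13.14 (p. 234), 14.14 (p. 243)]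
[cite: CoatesSujatha2005, statement (A)] [cite: Miller2011LMS, Def. 1.1] -/
theorem missingUpperBoundAt_two_of_katoFineSelmerAtTwoSharp
    (hSharp : Kato2004.rankZero_padicValNat_sha_add_padicValNat_tamagawa_le_at_two_of_irreducible_of_fineSelmerDual_fg)
    (hGZK : rank_eq_analyticRank_of_analyticRank_le_one) (hmod : hasEntireLFunction_rat)
    (W : WeierstrassCurve ℚ) [W.IsElliptic] [W.IsGloballyMinimal] (hcm : ¬ W.HasCM) (hr : W.analyticRank = 0)
    (hdef : DefectAtLeastThree W) (hirr : W.HasIrreducibleModPGaloisRep 2)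
    (hA : ∀ (κ : ZpExtension ℚ 2), κ.IsCyclotomic →
      ∃ (γ : Field.absoluteGaloisGroup ℚ) (D : W.FineSelmerDualData κ γ),
        Module.Finite ℤ_[2] (RestrictScalars ℤ_[2] (IwasawaAlgebra 2) D.X)) :
    MissingUpperBoundAt W 2 := by
  obtain ⟨q, hq, hle⟩ :=
    padicValNat_shaOrder_le_of_katoFineSelmerAtTwoSharp_rankZero hSharp hGZK hmod W hcm hdef.1.1 hdef.1.2
      (potGood_of_defectAtLeastThree W hdef) hirr hA hr
  rw [padicValNat_torsionOrder_eq_zero_of_irreducible W 2 hirr] at hle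
  simp only [Nat.cast_zero, mul_zero, sub_zero] at hle
  exact ⟨q, hq, hle⟩

/-! ## §3 BSD₂ AT A CURVE of the sub-block {E[2] irreducible}: statement (A) + the LOWER half -/

/-- **BSD₂ at a curve of the sub-block {E[2] irreducible} from statement (A) at `(E,2)` and the LOWER half.** The upper
half by `missingUpperBoundAt_two_of_katoFineSelmerAtTwoSharp`; with `MissingLowerBoundAt W 2` (the «main-conjecture»
direction, however obtained) `missingPPartAt_of_lower_of_upper` and `bsdp_of_missingPPartAt` give `BSDp W 2`.
[cite: Kato2004Asterisque, Thm. 12.5 (1)(3) (pp. 221–222), 13.8 (pp. 227–229), 14.14 (p. 243)]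
[cite: CoatesSujatha2005, statement (A)] [cite: Miller2011LMS, §1 and Def. 1.1] -/
theorem bsdp_two_of_katoFineSelmerAtTwoSharp_of_lower
    (hSharp : Kato2004.rankZero_padicValNat_sha_add_padicValNat_tamagawa_le_at_two_of_irreducible_of_fineSelmerDual_fg)
    (hGZK : rank_eq_analyticRank_of_analyticRank_le_one) (hmod : hasEntireLFunction_rat)
    (W : WeierstrassCurve ℚ) [W.IsElliptic] [W.IsGloballyMinimal] (hcm : ¬ W.HasCM) (hr : W.analyticRank = 0)
    (hdef : DefectAtLeastThree W) (hirr : W.HasIrreducibleModPGaloisRep 2)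
    (hA : ∀ (κ : ZpExtension ℚ 2), κ.IsCyclotomic →
      ∃ (γ : Field.absoluteGaloisGroup ℚ) (D : W.FineSelmerDualData κ γ),
        Module.Finite ℤ_[2] (RestrictScalars ℤ_[2] (IwasawaAlgebra 2) D.X))
    (hlow : MissingLowerBoundAt W 2) : BSDp W 2 := by
  have hr1 : W.analyticRank ≤ 1 := by rw [hr]; exact zero_le_one
  exact bsdp_of_missingPPartAt W 2 hGZK hr1
    (missingPPartAt_of_lower_of_upper W 2 hlow
      (missingUpperBoundAt_two_of_katoFineSelmerAtTwoSharp hSharp hGZK hmod W hcm hr hdef hirr hA))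

/-- **The per-class door, sharp form: BSD₂ at a curve of the sub-block {E[2] irreducible} from statement (A) at `(E,2)`
and the two-engine LOWER certificate** (`#Ш_an = q` with `ord₂ q ≤ 2k`; `2^{2k−1} ∣ #Ш`, whence `2^{2k} ∣ #Ш` by
Cassels–Tate squareness, `missingLowerBoundAt_of_casselsTate_of_pow_dvd`). Compared with the GEN 5 door
`bsdp_two_of_katoFineSelmerAtTwo_of_certificates'` the evenness of `ord₂ q` is no longer needed on the UPPER side.
Inputs BY NAME: the sharp reading (flagged), GZK, modularity, Cassels–Tate (lower side); (A) at `(W,2)` stays displayed.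
[cite: Kato2004Asterisque, Thm. 12.5 (1)(3) (pp. 221–222), 13.8 (pp. 227–229), 14.14 (p. 243)]
[cite: SilvermanAEC2009, Thm. X.4.14] [cite: CoatesSujatha2005, statement (A)] [cite: Miller2011LMS, §1 and Def. 1.1] -/
theorem bsdp_two_of_katoFineSelmerAtTwoSharp_of_certificates
    (hSharp : Kato2004.rankZero_padicValNat_sha_add_padicValNat_tamagawa_le_at_two_of_irreducible_of_fineSelmerDual_fg)
    (hGZK : rank_eq_analyticRank_of_analyticRank_le_one) (hmod : hasEntireLFunction_rat)
    (hCT : exists_casselsTate_pairing (K := ℚ))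
    (W : WeierstrassCurve ℚ) [W.IsElliptic] [W.IsGloballyMinimal] (hcm : ¬ W.HasCM) (hr : W.analyticRank = 0)
    (hdef : DefectAtLeastThree W) (hirr : W.HasIrreducibleModPGaloisRep 2)
    (hA : ∀ (κ : ZpExtension ℚ 2), κ.IsCyclotomic →
      ∃ (γ : Field.absoluteGaloisGroup ℚ) (D : W.FineSelmerDualData κ γ),
        Module.Finite ℤ_[2] (RestrictScalars ℤ_[2] (IwasawaAlgebra 2) D.X))
    {q : ℚ} (hq : shaAn W = (q : ℂ)) {k : ℕ} (hk : padicValRat 2 q ≤ 2 * k)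
    (hdvd : 2 ^ (2 * k - 1) ∣ W.shaOrder) : BSDp W 2 := by
  have hfin : W.ShaFinite := (hGZK W (by rw [hr]; exact zero_le_one)).2
  exact bsdp_two_of_katoFineSelmerAtTwoSharp_of_lower hSharp hGZK hmod W hcm hr hdef hirr hA
    (missingLowerBoundAt_of_casselsTate_of_pow_dvd W 2 hCT hfin hq hk hdvd)

/-! ## §4 The ∀ shapes (for the tenure planner): what is left of hU3 on the defect-≥3 block -/

/-- **The stub `stub_addDefectUpper` (hU3) on the sub-block {E[2] irreducible}, REDUCED TO ONE NAMED CONJECTURE PER CURVE,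
with NO parity certificate.** Granted the SHARP `p = 2` reading of Kato (flagged Literature fact), GZK and modularity: for
every non-CM `r_an = 0` curve of the defect-≥3 block with irreducible `E[2]` (either sign of `Δ`), statement (A) of
Coates–Sujatha at `(E, 2)` implies `MissingUpperBoundAt W 2` — the conclusion of `stub_addDefectUpper` at `W`. Supersedes
the GEN 5 shapes `addDefectUpper_{negDisc_,}irreducible_of_conjA_of_even` (evenness hypothesis and Cassels–Tate GONE).
Nothing about (A) or the reading is asserted (conditional; the stub and the item are NOT closed by this theorem).
[cite: Kato2004Asterisque, Thm. 12.5 (1)(3) (pp. 221–222), 13.8 (pp. 227–229), 13.14 (p. 234), 14.14 (p. 243)]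
[cite: CoatesSujatha2005, statement (A)] [cite: Miller2011LMS, Def. 1.1] -/
theorem addDefectUpper_irreducible_of_conjA
    (hSharp : Kato2004.rankZero_padicValNat_sha_add_padicValNat_tamagawa_le_at_two_of_irreducible_of_fineSelmerDual_fg)
    (hGZK : rank_eq_analyticRank_of_analyticRank_le_one) (hmod : hasEntireLFunction_rat) :
    ∀ (W : WeierstrassCurve ℚ) [W.IsElliptic] [W.IsGloballyMinimal], ¬ W.HasCM → W.analyticRank = 0 →
      DefectAtLeastThree W → W.HasIrreducibleModPGaloisRep 2 →
      (∀ (κ : ZpExtension ℚ 2), κ.IsCyclotomic →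
        ∃ (γ : Field.absoluteGaloisGroup ℚ) (D : W.FineSelmerDualData κ γ),
          Module.Finite ℤ_[2] (RestrictScalars ℤ_[2] (IwasawaAlgebra 2) D.X)) →
      MissingUpperBoundAt W 2 :=
  fun W _ _ hcm hr hdef hirr hA =>
    missingUpperBoundAt_two_of_katoFineSelmerAtTwoSharp hSharp hGZK hmod W hcm hr hdef hirr hA

/-- **The registered stub `stub_addDefectUpper` VERBATIM, from its exact residual.** Granted the SHARP reading, GZK and
modularity: IF statement (A) of Coates–Sujatha holds at `(E, 2)` for every non-CM `r_an = 0` curve of the defect-≥3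
block with IRREDUCIBLE `E[2]` (`hA`; a named published conjecture, here a displayed hypothesis), AND the upper half
`MissingUpperBoundAt W 2` holds for every such curve with REDUCIBLE `E[2]` (`hred`; the 210-class sub-block with a
rational `2`-torsion point, for which no reading exists — Kato's 12.5 (4)/12.6 route needs `E(ℚ)[2] = 0`), THEN
`∀ W, ¬CM → r_an = 0 → DefectAtLeastThree W → MissingUpperBoundAt W 2` — literally the signature of
`stub_addDefectUpper` (line add_twist_overK v2). Displays exactly what is left of hU3 after this file; conditional,
nothing asserted. [cite: Kato2004Asterisque, Thm. 12.5 (1)(3)(4) (pp. 221–222), 13.14 (p. 234)]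
[cite: CoatesSujatha2005, statement (A)] [cite: Miller2011LMS, Def. 1.1] -/
theorem addDefectUpper_of_conjA_of_reducibleUpper
    (hSharp : Kato2004.rankZero_padicValNat_sha_add_padicValNat_tamagawa_le_at_two_of_irreducible_of_fineSelmerDual_fg)
    (hGZK : rank_eq_analyticRank_of_analyticRank_le_one) (hmod : hasEntireLFunction_rat)
    (hA : ∀ (W : WeierstrassCurve ℚ) [W.IsElliptic] [W.IsGloballyMinimal], ¬ W.HasCM → W.analyticRank = 0 →
      DefectAtLeastThree W → W.HasIrreducibleModPGaloisRep 2 →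
      ∀ (κ : ZpExtension ℚ 2), κ.IsCyclotomic →
        ∃ (γ : Field.absoluteGaloisGroup ℚ) (D : W.FineSelmerDualData κ γ),
          Module.Finite ℤ_[2] (RestrictScalars ℤ_[2] (IwasawaAlgebra 2) D.X))
    (hred : ∀ (W : WeierstrassCurve ℚ) [W.IsElliptic] [W.IsGloballyMinimal], ¬ W.HasCM → W.analyticRank = 0 →
      DefectAtLeastThree W → ¬ W.HasIrreducibleModPGaloisRep 2 → MissingUpperBoundAt W 2) :
    ∀ (W : WeierstrassCurve ℚ) [W.IsElliptic] [W.IsGloballyMinimal], ¬ W.HasCM → W.analyticRank = 0 →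
      DefectAtLeastThree W → MissingUpperBoundAt W 2 := by
  intro W _ _ hcm hr hdef
  by_cases hirr : W.HasIrreducibleModPGaloisRep 2
  · exact missingUpperBoundAt_two_of_katoFineSelmerAtTwoSharp hSharp hGZK hmod W hcm hr hdef hirr
      (hA W hcm hr hdef hirr)
  · exact hred W hcm hr hdef hirr

/-- **BSD₂ on the sub-block {E[2] irreducible} from statement (A) and the LOWER half, ∀ shape.** Granted the SHARP reading,
GZK and modularity: for every non-CM `r_an = 0` curve of the defect-≥3 block with irreducible `E[2]`, (A) at `(E,2)` and
`MissingLowerBoundAt W 2` give `BSDp W 2` — the block's `BSD₂` is reduced to «(A) at 2 + the main-conjecture half».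
Conditional; nothing asserted. [cite: Kato2004Asterisque, Thm. 12.5 (1)(3) (pp. 221–222), 14.14 (p. 243)]
[cite: CoatesSujatha2005, statement (A)] [cite: Miller2011LMS, §1 and Def. 1.1] -/
theorem addDefectBSDp_irreducible_of_conjA_of_lower
    (hSharp : Kato2004.rankZero_padicValNat_sha_add_padicValNat_tamagawa_le_at_two_of_irreducible_of_fineSelmerDual_fg)
    (hGZK : rank_eq_analyticRank_of_analyticRank_le_one) (hmod : hasEntireLFunction_rat) :
    ∀ (W : WeierstrassCurve ℚ) [W.IsElliptic] [W.IsGloballyMinimal], ¬ W.HasCM → W.analyticRank = 0 →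
      DefectAtLeastThree W → W.HasIrreducibleModPGaloisRep 2 →
      (∀ (κ : ZpExtension ℚ 2), κ.IsCyclotomic →
        ∃ (γ : Field.absoluteGaloisGroup ℚ) (D : W.FineSelmerDualData κ γ),
          Module.Finite ℤ_[2] (RestrictScalars ℤ_[2] (IwasawaAlgebra 2) D.X)) →
      MissingLowerBoundAt W 2 → BSDp W 2 :=
  fun W _ _ hcm hr hdef hirr hA hlow =>
    bsdp_two_of_katoFineSelmerAtTwoSharp_of_lower hSharp hGZK hmod W hcm hr hdef hirr hA hlow

end Summit.BirchSwinnertonDyer.BirchSwinnertonDyer.Theorems.AddKatoTwo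

end
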